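import Summits.ValiantsHypothesis.ValiantsHypothesis.Theorems.DepthWindowULBTwo
import Summits.ValiantsHypothesis.ValiantsHypothesis.Theorems.DepthWindowULPBReduction

/-!
# Route `DepthWindow` — level A of the carrier round: extraction plus the carrier block

Cone-free theorem (decomp-valiant lens 4, g16→g17) supporting the crux item `HomImmHardTwoOne`
(stmt-ValiantsHypothesis-30635): level A of `CarrierRound` (`DepthWindowULPBReduction.lean`, NODE-v16
`CARRIER-ROUND-PLAN.md`).  The extraction of `DepthWindowExtraction.lean` is run on the small non-carrier letters
`U = {i ≠ κ : |x i| ≤ v}` and ONE extra group is formed: the carrier together with all pending letters,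
`{κ} ∪ pendSet x κ v`.  Recorded as a surjective relabelling `c₁` with: the carrier group is exactly
`insert κ (pendSet x κ v)`; every other group is a singleton `{a}` or an extraction segment (`ℓ·|sum| < 2v`, mass
`≤ ℓ v`); every non-carrier letter of the quotient word comes from a small node; and the big letters of the
quotient word outside the carrier (modulus `> ⌊(2v−1)/ℓ⌋`) of ONE sign number `< ℓ`, so their mass is `≤ (ℓ−1)·v`
(the input `hmin` of the carrier refresh `exists_carrierRefresh`).

* `exists_carrierExtraction` — the statement above.

References: [LimayeSrinivasanTavenas2022] full version ECCC TR22-090, Algorithm 1, Lemma 21, Claim 28.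
-/

-- layout Summits/ValiantsHypothesis/ValiantsHypothesis forces the duplicated namespace component
set_option linter.dupNamespace false

namespace Summit.ValiantsHypothesis.ValiantsHypothesis.Theorems.DepthWindow.TreeBias

open Finset

variable {n : ℕ}

/-- **Level A of the carrier round.**  See the module docstring. [cite: LimayeSrinivasanTavenas2022, Algorithm 1] -/
theorem exists_carrierExtraction (x : Fin n → ℤ) (κ : Fin n) (v : ℕ) {ℓ : ℕ} (hℓ : 1 ≤ ℓ) :
    ∃ (M₁ : ℕ) (c₁ : Fin n → Fin M₁), Function.Surjective c₁ ∧
      univ.filter (fun j => c₁ j = c₁ κ) = insert κ (pendSet x κ v) ∧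
      (∀ a, a ≠ κ → a ∉ pendSet x κ v → c₁ a ≠ c₁ κ ∧ |x a| ≤ v ∧
        (univ.filter (fun j => c₁ j = c₁ a) = {a} ∨
          ((ℓ : ℤ) * |quotWord x c₁ (c₁ a)| < 2 * v ∧
            ∑ j ∈ univ.filter (fun j => c₁ j = c₁ a), |x j| ≤ (ℓ : ℤ) * v))) ∧
      (∀ m, m ≠ c₁ κ → ∃ a, a ≠ κ ∧ a ∉ pendSet x κ v ∧ c₁ a = m) ∧
      (∑ m ∈ (univ.filter fun m => m ≠ c₁ κ).filter
          (fun m => (((2 * v - 1) / ℓ : ℕ) : ℤ) < quotWord x c₁ m), quotWord x c₁ m ≤ ((ℓ : ℤ) - 1) * v ∨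
        -(∑ m ∈ (univ.filter fun m => m ≠ c₁ κ).filter
          (fun m => quotWord x c₁ m < -(((2 * v - 1) / ℓ : ℕ) : ℤ)), quotWord x c₁ m) ≤ ((ℓ : ℤ) - 1) * v) := by
  classical
  set P := pendSet x κ v with hPdef
  set U := univ.filter (fun i => i ≠ κ ∧ |x i| ≤ (v : ℤ)) with hUdef
  have hUin : ∀ i ∈ U, |x i| ≤ v := fun i hi => (mem_filter.1 hi).2.2
  have hκU : κ ∉ U := fun h => (mem_filter.1 h).2.1 rfl
  have hPU : ∀ i ∈ P, i ∉ U := fun i hi hU => by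
    have h1 := (mem_filter.1 hi).2.2; have h2 := (mem_filter.1 hU).2.2; exact not_lt.2 h2 h1
  have hUof : ∀ i, i ≠ κ → i ∉ P → i ∈ U := by
    intro i h1 h2
    have h3 : ¬ ((v : ℤ) < |x i|) := fun h =>
      h2 (by rw [hPdef, pendSet]; exact mem_filter.2 ⟨mem_univ _, h1, h⟩)
    exact mem_filter.2 ⟨mem_univ _, h1, not_lt.1 h3⟩
  -- the extraction on the small non-carrier letters
  obtain ⟨L, hidem, hout, hfib, hrest⟩ := exists_extraction x (v := v) (ℓ := ℓ) hℓ U hUin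
  have hLout : ∀ j, j ∉ U → L j = j := fun j hj => (hout j hj j).2 rfl
  have hLU : ∀ i ∈ U, L i ∈ U := by
    intro i hi
    rcases hfib i with hs | ⟨hall, _, _⟩
    · have h1 : L i = i := (hs (L i)).1 (hidem i)
      rw [h1]; exact hi
    · exact hall (L i) (hidem i)
  -- the carrier block `C = {κ} ∪ P` and the modified leader map
  set C := insert κ P with hCdef
  have hκC : κ ∈ C := mem_insert_self κ P
  have hCU : ∀ i ∈ C, i ∉ U := fun i hi => by
    rcases mem_insert.1 hi with rfl | hi
    · exact hκU
    · exact hPU i hi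
  have hUC : ∀ i ∈ U, i ∉ C := fun i hi hC => hCU i hC hi
  have hUof' : ∀ i, i ∉ C → i ∈ U := fun i hi =>
    hUof i (fun h => hi (by rw [h]; exact hκC)) (fun h => hi (mem_insert_of_mem h))
  let L' : Fin n → Fin n := fun i => if i ∈ C then κ else L i
  have hL'C : ∀ i ∈ C, L' i = κ := fun i hi => by
    show (if i ∈ C then κ else L i) = κ; rw [if_pos hi]
  have hL'U : ∀ i, i ∉ C → L' i = L i := fun i hi => by
    show (if i ∈ C then κ else L i) = L i; rw [if_neg hi]
  have hidem' : ∀ i, L' (L' i) = L' i := by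
    intro i
    by_cases hi : i ∈ C
    · rw [hL'C i hi, hL'C κ hκC]
    · have hLi : L i ∈ U := hLU i (hUof' i hi)
      rw [hL'U i hi, hL'U (L i) (hUC _ hLi), hidem i]
  have hfibC : ∀ j, L' j = κ ↔ j ∈ C := by
    intro j
    by_cases hj : j ∈ C
    · exact ⟨fun _ => hj, fun _ => hL'C j hj⟩
    · rw [hL'U j hj]
      constructor
      · intro h
        have : κ ∈ U := by rw [← h]; exact hLU j (hUof' j hj)
        exact absurd this hκU
      · intro h; exact absurd h hj
  have hfibU : ∀ a, a ∉ C → ∀ j, L' j = L' a ↔ L j = L a := by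
    intro a ha j
    rw [hL'U a ha]
    by_cases hj : j ∈ C
    · rw [hL'C j hj]
      constructor
      · intro h
        have : κ ∈ U := by rw [h]; exact hLU a (hUof' a ha)
        exact absurd this hκU
      · intro h
        exfalso
        rw [hLout j (hCU j hj)] at h
        have : j ∈ U := by rw [h]; exact hLU a (hUof' a ha)
        exact hCU j hj this
    · rw [hL'U j hj]
  -- the quotient
  obtain ⟨M₁, c₁, rep, hc₁, hrep, hciff, _⟩ := exists_quotient_of_leader L' hidem'
  have hrepc : ∀ i, rep (c₁ i) = L' i := fun i => ((hciff i (c₁ i)).1 rfl).symm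
  have hcrep : ∀ m, c₁ (rep m) = m := fun m => (hciff _ _).2 (hrep m)
  have hfibre : ∀ i, univ.filter (fun j => c₁ j = c₁ i) = univ.filter (fun j => L' j = L' i) := by
    intro i; ext j; simp only [mem_filter, mem_univ, true_and, hciff, hrepc]
  have hrepC : ∀ m, m ≠ c₁ κ → rep m ∉ C := by
    intro m hm hC
    have h1 : L' (rep m) = κ := hL'C _ hC
    rw [hrep m] at h1
    exact hm (by rw [← hcrep m, h1])
  -- the quotient letter of a small node: its own value (singleton) or a segment sum
  have hzfib : ∀ a, a ∉ C → quotWord x c₁ (c₁ a) = ∑ j ∈ univ.filter (fun j => L j = L a), x j := by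
    intro a ha
    rw [quotWord, hfibre]
    refine sum_congr ?_ fun _ _ => rfl
    ext j; simp only [mem_filter, mem_univ, true_and, hfibU a ha j]
  have hsing : ∀ a, (∀ j, L j = L a ↔ j = a) → univ.filter (fun j => L j = L a) = {a} := by
    intro a hs; ext j; simp [hs j]
  -- the big letters of the quotient word outside the carrier are big singleton rest letters
  have key : ∀ m, m ≠ c₁ κ → (((2 * v - 1) / ℓ : ℕ) : ℤ) < |quotWord x c₁ m| →
      rep m ∈ U ∧ (∀ j, L j = L (rep m) ↔ j = rep m) ∧ ¬ ((ℓ : ℤ) * |x (rep m)| < 2 * v) ∧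
        quotWord x c₁ m = x (rep m) := by
    intro m hm hbig
    have ha : rep m ∉ C := hrepC m hm
    have haU : rep m ∈ U := hUof' _ ha
    have hzm : quotWord x c₁ m = ∑ j ∈ univ.filter (fun j => L j = L (rep m)), x j := by
      rw [← hzfib _ ha, hcrep]
    rcases hfib (rep m) with hs | ⟨_, hsm, _⟩
    · have hval : quotWord x c₁ m = x (rep m) := by rw [hzm, hsing _ hs, sum_singleton]
      refine ⟨haU, hs, fun hlt => ?_, hval⟩
      have h1 := abs_le_div_of_mul_abs_lt hℓ hlt
      rw [← hval] at h1
      exact not_lt.2 h1 hbig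
    · exfalso
      have h1 := abs_le_div_of_mul_abs_lt hℓ hsm
      rw [← hzm] at h1
      exact not_lt.2 h1 hbig
  refine ⟨M₁, c₁, hc₁, ?_, fun a haκ haP => ?_, fun m hm => ?_, ?_⟩
  · -- the carrier group
    rw [hfibre, hL'C κ hκC]
    ext j; simp only [mem_filter, mem_univ, true_and, hfibC j, hCdef, hPdef]
  · -- a small node
    have ha : a ∉ C := fun h => by
      rcases mem_insert.1 h with h | h
      · exact haκ h
      · exact haP h
    have haU : a ∈ U := hUof' a ha
    refine ⟨fun h => ?_, hUin a haU, ?_⟩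
    · have h1 : L' a = L' κ := by rw [← hrepc a, ← hrepc κ, h]
      rw [hL'C κ hκC, hfibC] at h1
      exact ha h1
    · have hfa : univ.filter (fun j => c₁ j = c₁ a) = univ.filter (fun j => L j = L a) := by
        rw [hfibre]; ext j; simp only [mem_filter, mem_univ, true_and, hfibU a ha j]
      rcases hfib a with hs | ⟨_, hsm, hm⟩
      · left; rw [hfa, hsing a hs]
      · right
        rw [hzfib a ha, hfa]
        exact ⟨hsm, hm⟩
  · -- every non-carrier letter comes from a small node
    have ha : rep m ∉ C := hrepC m hm
    exact ⟨rep m, fun h => ha (by rw [h]; exact hκC), fun h => ha (mem_insert_of_mem h), hcrep m⟩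
  · -- the big letters of one sign have mass ≤ (ℓ − 1)·v
    have hv0 : (0 : ℤ) ≤ v := Nat.cast_nonneg v
    have he0 : (0 : ℤ) ≤ (((2 * v - 1) / ℓ : ℕ) : ℤ) := Nat.cast_nonneg _
    have hinj : Set.InjOn rep (Set.univ : Set (Fin M₁)) := by
      intro m₁ _ m₂ _ h
      rw [← hcrep m₁, ← hcrep m₂]
      exact congrArg c₁ h
    rcases hrest with hpos | hneg
    · left
      set Rp := U.filter (fun i => (∀ j, L j = L i ↔ j = i) ∧ ¬ ((ℓ : ℤ) * |x i| < 2 * v) ∧ 0 < x i)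
        with hRp
      set Bp := (univ.filter fun m => m ≠ c₁ κ).filter
        (fun m => (((2 * v - 1) / ℓ : ℕ) : ℤ) < quotWord x c₁ m) with hBp
      have hmemB : ∀ m ∈ Bp, rep m ∈ Rp ∧ quotWord x c₁ m = x (rep m) := by
        intro m hm
        obtain ⟨hm1, hm2⟩ := mem_filter.1 hm
        have hmκ : m ≠ c₁ κ := (mem_filter.1 hm1).2
        have hbig : (((2 * v - 1) / ℓ : ℕ) : ℤ) < |quotWord x c₁ m| := lt_of_lt_of_le hm2 (le_abs_self _)
        obtain ⟨haU, hs, hnb, hval⟩ := key m hmκ hbig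
        refine ⟨mem_filter.2 ⟨haU, hs, hnb, ?_⟩, hval⟩
        rw [← hval]; linarith
      have hcard : Bp.card ≤ Rp.card :=
        card_le_card_of_injOn rep (fun m hm => (hmemB m hm).1) fun m₁ _ m₂ _ h => hinj (Set.mem_univ _)
          (Set.mem_univ _) h
      calc ∑ m ∈ Bp, quotWord x c₁ m ≤ ∑ m ∈ Bp, (v : ℤ) := sum_le_sum fun m hm => by
              rw [(hmemB m hm).2]
              exact (le_abs_self _).trans (hUin _ (mem_filter.1 (hmemB m hm).1).1)
        _ = (Bp.card : ℤ) * v := by rw [sum_const, nsmul_eq_mul]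
        _ ≤ ((ℓ : ℤ) - 1) * v := by
            have h1 : (Bp.card : ℤ) ≤ Rp.card := by exact_mod_cast hcard
            have h2 : (Rp.card : ℤ) < ℓ := by exact_mod_cast hpos
            nlinarith
    · right
      set Rn := U.filter (fun i => (∀ j, L j = L i ↔ j = i) ∧ ¬ ((ℓ : ℤ) * |x i| < 2 * v) ∧ x i < 0)
        with hRn
      set Bn := (univ.filter fun m => m ≠ c₁ κ).filter
        (fun m => quotWord x c₁ m < -(((2 * v - 1) / ℓ : ℕ) : ℤ)) with hBn
      have hmemB : ∀ m ∈ Bn, rep m ∈ Rn ∧ quotWord x c₁ m = x (rep m) := by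
        intro m hm
        obtain ⟨hm1, hm2⟩ := mem_filter.1 hm
        have hmκ : m ≠ c₁ κ := (mem_filter.1 hm1).2
        have hbig : (((2 * v - 1) / ℓ : ℕ) : ℤ) < |quotWord x c₁ m| :=
          lt_of_lt_of_le (by linarith) (neg_le_abs _)
        obtain ⟨haU, hs, hnb, hval⟩ := key m hmκ hbig
        refine ⟨mem_filter.2 ⟨haU, hs, hnb, ?_⟩, hval⟩
        rw [← hval]; linarith
      have hcard : Bn.card ≤ Rn.card :=
        card_le_card_of_injOn rep (fun m hm => (hmemB m hm).1) fun m₁ _ m₂ _ h => hinj (Set.mem_univ _)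
          (Set.mem_univ _) h
      rw [← sum_neg_distrib]
      calc ∑ m ∈ Bn, -quotWord x c₁ m ≤ ∑ m ∈ Bn, (v : ℤ) := sum_le_sum fun m hm => by
              rw [(hmemB m hm).2]
              exact (neg_le_abs _).trans (hUin _ (mem_filter.1 (hmemB m hm).1).1)
        _ = (Bn.card : ℤ) * v := by rw [sum_const, nsmul_eq_mul]
        _ ≤ ((ℓ : ℤ) - 1) * v := by
            have h1 : (Bn.card : ℤ) ≤ Rn.card := by exact_mod_cast hcard
            have h2 : (Rn.card : ℤ) < ℓ := by exact_mod_cast hneg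
            nlinarith

end Summit.ValiantsHypothesis.ValiantsHypothesis.Theorems.DepthWindow.TreeBias
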